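import Mathlib
import HarnessLib

/-!
# LINE (A) `product_plus_one` (crux `MatrixDescartes`, stmt-ValiantsHypothesis-18050, V1) — W-CB engine: the CROSSING SHELL
# «if the down-crossing set `𝒥` is an interval then `D = log G − log ΣB` has no five zeros»

Owner memo `pub/ideators/val-idea-25/NOTE-idea25g3-18050-LINEA-AB-reduction.md` §22–§24 (val-idea-25 g4/g5, W-CB, T1) and
`pub/val-lit/lmr/NOTE-p8g17-18050-pure-2N-law.md` §2, §6 (val-lit-p8 g17).  For a pole-free window of a binomial company the
log-Wronskian is `W(∏f)/∏f² = ΣB − G` (knees `B`, pulls `G`); with `g := (log G)′` (strictly increasing, onto `ℝ` between two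
poles) and `ℓ := (log ΣB)′`, the zeros of `W(∏f)` are the zeros of `D := log G − log ΣB`, whose critical points are the
CROSSINGS `g = ℓ`.  The function `W := g⁻¹ ∘ ℓ − id` vanishes exactly at the crossings and has `W′ = ℓ′/g′(g⁻¹∘ℓ) − 1`, so it is
non-increasing off the set `𝒥 := {t | ℓ′ t > g′(g⁻¹(ℓ t))}` and increasing on it.  This file proves the degeneracy-free
counting shell, in an abstract real-variable form (no rows, no `rowPsi`):

* ★ `crossingShell_no_five_zeros` — `g ∈ C¹` with `g′ > 0` on `(a,b)`, `ℓ` differentiable with `ℓ((a,b)) ⊆ g((a,b))`, `D′ = g − ℓ`;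
  if `𝒥` is order-connected in `(a,b)` (three-point betweenness — no local-max/min language) and the crossing set `{g = ℓ}`
  contains no interval, then `D` does not vanish at five points of `(a,b)`.  Tangential crossings and inflection-type critical
  points cost nothing (the count goes through the monotonicity of `W`, not through the types of the critical points).

The cell files owe: (i) the interval property of `𝒥` for the knee aggregate against the pole family (located for two knees of
any rates, memo §6; for two knees of one rate it is the concavity of `M_B(y) := y² + ℓ′` in the mean coordinate `y = ℓ` plus the
convexity of `M_G(y) := y² + g′∘g⁻¹`, the latter PROVED on paper for every pole background by Pearson's `β₂ ≥ β₁ + 1`),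
(ii) row algebra already in ✓ `…ThetaShell` / ✓ `…OneBump`.  Honest framing: a conditional real-analysis shell; nothing here
proves `WronskianBudgetK3` / `OneChangeFloorK3` / the stubs / 18050 / `MatrixDescartes`; `VP ≠ VNP` is NOT proved.
No definitions, no named facts; Mathlib only (the one-variable smooth-inverse facts are inlined from the folklore of
`Literature.Analysis.Calculus.MonotoneSmoothInverse`, which is outside this summit's build cone).
-/

set_option linter.dupNamespace false

namespace Summit.ValiantsHypothesis.ValiantsHypothesis.Theorems.LacunarySymmetroidMatrixDescartes

namespace ProductPlusOne

open Set Function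
open scoped Topology

/-- On an order-connected block where `W` is monotone or antitone, two zeros of `W` force `W ≡ 0` between them.
[this file's lemma] -/
theorem eq_zero_between_of_monotoneOn_or_antitoneOn {W : ℝ → ℝ} {B : Set ℝ}
    (hW : MonotoneOn W B ∨ AntitoneOn W B) {c d t : ℝ} (hc : c ∈ B) (hd : d ∈ B) (ht : t ∈ B)
    (hct : c ≤ t) (htd : t ≤ d) (hWc : W c = 0) (hWd : W d = 0) : W t = 0 := by
  rcases hW with hW | hW
  · exact le_antisymm (by simpa [hWd] using hW ht hd htd) (by simpa [hWc] using hW hc ht hct)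
  · exact le_antisymm (by simpa [hWc] using hW hc ht hct) (by simpa [hWd] using hW ht hd htd)

/-- ★ **THE CROSSING SHELL.**  Let `g` be `C¹` with `deriv g > 0` on the window `(a,b)`, `ℓ` differentiable there with
`ℓ t ∈ g '' (a,b)`, and `D′ = g − ℓ`.  Let `𝒥 t :⟺ ∃ s ∈ (a,b), g s = ℓ t ∧ deriv g s < ℓ′ t` («`ℓ` is steeper than `g` at the
point of equal height» — the down-crossing set).  If `𝒥` is order-connected in `(a,b)` and the crossing set `{g = ℓ}` contains
no open interval, then `D` has no five zeros in `(a,b)`.  Proof: `W := invFunOn g (a,b) ∘ ℓ − id` has the crossings as zeros,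
`W′ = ℓ′/g′(g⁻¹ℓ) − 1 ≤ 0` off `𝒥` and `> 0` on `𝒥`, so `W` is monotone on three consecutive blocks; five zeros of `D` give four
crossings (Rolle), two in one block, hence a whole interval of crossings. [this file's theorem] -/
theorem crossingShell_no_five_zeros {a b : ℝ} {g ℓ ℓ' D : ℝ → ℝ}
    (hg : ContDiffOn ℝ 1 g (Ioo a b)) (hgpos : ∀ t ∈ Ioo a b, 0 < deriv g t)
    (hℓ : ∀ t ∈ Ioo a b, HasDerivAt ℓ (ℓ' t) t) (hran : ∀ t ∈ Ioo a b, ℓ t ∈ g '' Ioo a b)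
    (hD : ∀ t ∈ Ioo a b, HasDerivAt D (g t - ℓ t) t)
    (hJ : ∀ t₁ ∈ Ioo a b, ∀ t₂ ∈ Ioo a b, ∀ t₃ ∈ Ioo a b, t₁ < t₂ → t₂ < t₃ →
      (∃ s ∈ Ioo a b, g s = ℓ t₁ ∧ deriv g s < ℓ' t₁) → (∃ s ∈ Ioo a b, g s = ℓ t₃ ∧ deriv g s < ℓ' t₃) →
      (∃ s ∈ Ioo a b, g s = ℓ t₂ ∧ deriv g s < ℓ' t₂))
    (hfin : ∀ c d, a ≤ c → c < d → d ≤ b → ∃ t ∈ Ioo c d, g t ≠ ℓ t)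
    {x₁ x₂ x₃ x₄ x₅ : ℝ} (h₁ : x₁ ∈ Ioo a b) (h₅ : x₅ ∈ Ioo a b)
    (h12 : x₁ < x₂) (h23 : x₂ < x₃) (h34 : x₃ < x₄) (h45 : x₄ < x₅)
    (hz₁ : D x₁ = 0) (hz₂ : D x₂ = 0) (hz₃ : D x₃ = 0) (hz₄ : D x₄ = 0) (hz₅ : D x₅ = 0) : False := by
  set I : Set ℝ := Ioo a b with hI
  have hIo : IsOpen I := isOpen_Ioo
  have hIc : I.OrdConnected := ordConnected_Ioo
  -- the inverse of `g` on the window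
  set inv : ℝ → ℝ := invFunOn g I with hinv
  have hmono : StrictMonoOn g I :=
    strictMonoOn_of_deriv_pos (convex_Ioo a b) hg.continuousOn (fun x hx => hgpos x (interior_subset hx))
  have hinv_mem : ∀ t ∈ I, inv (ℓ t) ∈ I ∧ g (inv (ℓ t)) = ℓ t := by
    intro t ht
    obtain ⟨x, hx, hxy⟩ := hran t ht
    exact invFunOn_pos ⟨x, hx, hxy⟩
  have hinv_g : ∀ t ∈ I, inv (g t) = t := fun t ht => hmono.injOn.leftInvOn_invFunOn ht
  -- derivative of the inverse at the points `ℓ t` (inverse function theorem, one variable; adapted from the folklore file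
  -- `Literature.Analysis.Calculus.MonotoneSmoothInverse`)
  have hinv_deriv : ∀ t ∈ I, HasDerivAt inv (deriv g (inv (ℓ t)))⁻¹ (ℓ t) := by
    intro t ht
    obtain ⟨hxs, hfx⟩ := hinv_mem t ht
    set x₀ := inv (ℓ t) with hx₀
    have hfa : ContDiffAt ℝ 1 g x₀ := hg.contDiffAt (hIo.mem_nhds hxs)
    have hstrict : HasStrictDerivAt g (deriv g x₀) x₀ := hfa.hasStrictDerivAt one_ne_zero
    have hleft : ∀ᶠ x in 𝓝 x₀, inv (g x) = x :=
      Filter.mem_of_superset (hIo.mem_nhds hxs) fun x hx => hinv_g x hx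
    have h := (hstrict.to_local_left_inverse (hgpos x₀ hxs).ne' hleft).hasDerivAt
    rwa [hfx] at h
  -- `W := inv ∘ ℓ − id`
  set W : ℝ → ℝ := fun t => inv (ℓ t) - t with hWdef
  set W' : ℝ → ℝ := fun t => (deriv g (inv (ℓ t)))⁻¹ * ℓ' t - 1 with hW'def
  have hWderiv : ∀ t ∈ I, HasDerivAt W (W' t) t := by
    intro t ht
    have h1 : HasDerivAt (fun t => inv (ℓ t)) ((deriv g (inv (ℓ t)))⁻¹ * ℓ' t) t :=
      (hinv_deriv t ht).comp t (hℓ t ht)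
    exact h1.sub (hasDerivAt_id t)
  -- zeros and signs of `W`
  have hW_zero_iff : ∀ t ∈ I, W t = 0 ↔ g t = ℓ t := by
    intro t ht
    constructor
    · intro h
      have : inv (ℓ t) = t := by simpa [hWdef, sub_eq_zero] using h
      have h2 := (hinv_mem t ht).2
      rw [this] at h2
      exact h2
    · intro h
      simp only [hWdef, ← h, hinv_g t ht, sub_self]
  -- sign of `W'`: `> 0` on `𝒥`, `≤ 0` off `𝒥`
  have hW'_pos : ∀ t ∈ I, (∃ s ∈ I, g s = ℓ t ∧ deriv g s < ℓ' t) → 0 < W' t := by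
    rintro t ht ⟨s, hs, hgs, hlt⟩
    have hs' : inv (ℓ t) = s := by
      have := hinv_g s hs
      rw [hgs] at this
      exact this
    have hgp : 0 < deriv g s := hgpos s hs
    have hmul : 1 < (deriv g s)⁻¹ * ℓ' t := by
      rw [← div_eq_inv_mul, one_lt_div hgp]
      exact hlt
    show 0 < (deriv g (inv (ℓ t)))⁻¹ * ℓ' t - 1
    rw [hs']
    linarith
  have hW'_nonpos : ∀ t ∈ I, ¬ (∃ s ∈ I, g s = ℓ t ∧ deriv g s < ℓ' t) → W' t ≤ 0 := by
    intro t ht hnot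
    have hmem := (hinv_mem t ht)
    have hgp : 0 < deriv g (inv (ℓ t)) := hgpos _ hmem.1
    have hge : ℓ' t ≤ deriv g (inv (ℓ t)) := by
      by_contra hlt
      push Not at hlt
      exact hnot ⟨inv (ℓ t), hmem.1, hmem.2, hlt⟩
    show (deriv g (inv (ℓ t)))⁻¹ * ℓ' t - 1 ≤ 0
    rw [sub_nonpos, ← div_eq_inv_mul, div_le_one hgp]
    exact hge
  -- the three blocks: `B₁` = below `𝒥`, `B₂ = 𝒥`, `B₃` = above `𝒥`
  set J : Set ℝ := {t | t ∈ I ∧ ∃ s ∈ I, g s = ℓ t ∧ deriv g s < ℓ' t} with hJdef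
  set B₁ : Set ℝ := {t | t ∈ I ∧ ∀ j ∈ J, t < j} with hB₁def
  set B₃ : Set ℝ := {t | t ∈ I ∧ (∃ j ∈ J, j < t) ∧ t ∉ J} with hB₃def
  have hJ_sub : J ⊆ I := fun t ht => ht.1
  have hB₁_sub : B₁ ⊆ I := fun t ht => ht.1
  have hB₃_sub : B₃ ⊆ I := fun t ht => ht.1
  -- every point of `I` lies in one of the blocks
  have hcover : ∀ t ∈ I, t ∈ B₁ ∨ t ∈ J ∨ t ∈ B₃ := by
    intro t ht
    by_cases htJ : t ∈ J
    · exact Or.inr (Or.inl htJ)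
    by_cases hlow : ∀ j ∈ J, t < j
    · exact Or.inl ⟨ht, hlow⟩
    · push Not at hlow
      obtain ⟨j, hj, hjt⟩ := hlow
      refine Or.inr (Or.inr ⟨ht, ⟨j, hj, lt_of_le_of_ne hjt ?_⟩, htJ⟩)
      rintro rfl
      exact htJ hj
  -- order-connectedness of the blocks
  have hJ_conn : ∀ {c d t}, c ∈ J → d ∈ J → c ≤ t → t ≤ d → t ∈ J := by
    intro c d t hc hd hct htd
    rcases hct.eq_or_lt with rfl | hct'
    · exact hc
    rcases htd.eq_or_lt with rfl | htd'
    · exact hd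
    have htI : t ∈ I := hIc.out hc.1 hd.1 ⟨hct, htd⟩
    exact ⟨htI, hJ c hc.1 t htI d hd.1 hct' htd' hc.2 hd.2⟩
  have hB₁_conn : ∀ {c d t}, c ∈ B₁ → d ∈ B₁ → c ≤ t → t ≤ d → t ∈ B₁ := by
    intro c d t hc hd hct htd
    exact ⟨hIc.out hc.1 hd.1 ⟨hct, htd⟩, fun j hj => lt_of_le_of_lt htd (hd.2 j hj)⟩
  have hB₃_conn : ∀ {c d t}, c ∈ B₃ → d ∈ B₃ → c ≤ t → t ≤ d → t ∈ B₃ := by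
    intro c d t hc hd hct htd
    have htI : t ∈ I := hIc.out hc.1 hd.1 ⟨hct, htd⟩
    obtain ⟨j, hj, hjc⟩ := hc.2.1
    refine ⟨htI, ⟨j, hj, lt_of_lt_of_le hjc hct⟩, fun htJ => ?_⟩
    -- if `t ∈ J` then, `J` being order-connected and `j < c ≤ t`, also `c ∈ J`: contradiction
    exact hc.2.2 (hJ_conn hj htJ hjc.le hct)
  -- convexity of the blocks
  have hJ_oc : J.OrdConnected := ⟨fun c hc d hd t ht => hJ_conn hc hd ht.1 ht.2⟩
  have hB₁_oc : B₁.OrdConnected := ⟨fun c hc d hd t ht => hB₁_conn hc hd ht.1 ht.2⟩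
  have hB₃_oc : B₃.OrdConnected := ⟨fun c hc d hd t ht => hB₃_conn hc hd ht.1 ht.2⟩
  -- `W` is continuous on `I` and has derivative `W'` there
  have hWcont : ∀ {B : Set ℝ}, B ⊆ I → ContinuousOn W B := fun hB t ht =>
    (hWderiv t (hB ht)).continuousAt.continuousWithinAt
  have hWwithin : ∀ {B : Set ℝ}, B ⊆ I → ∀ t ∈ interior B, HasDerivWithinAt W (W' t) (interior B) t :=
    fun hB t ht => (hWderiv t (hB (interior_subset ht))).hasDerivWithinAt
  -- monotonicity on the three blocks
  have hW_J : MonotoneOn W J :=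
    monotoneOn_of_hasDerivWithinAt_nonneg hJ_oc.convex (hWcont hJ_sub) (hWwithin hJ_sub)
      (fun t ht => (hW'_pos t (hJ_sub (interior_subset ht)) (interior_subset ht).2).le)
  have hW_B₁ : AntitoneOn W B₁ :=
    antitoneOn_of_hasDerivWithinAt_nonpos hB₁_oc.convex (hWcont hB₁_sub) (hWwithin hB₁_sub)
      (fun t ht => hW'_nonpos t (hB₁_sub (interior_subset ht)) (fun hex => by
        have htB := interior_subset (s := B₁) ht
        exact lt_irrefl t (htB.2 t ⟨htB.1, hex⟩)))
  have hW_B₃ : AntitoneOn W B₃ :=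
    antitoneOn_of_hasDerivWithinAt_nonpos hB₃_oc.convex (hWcont hB₃_sub) (hWwithin hB₃_sub)
      (fun t ht => hW'_nonpos t (hB₃_sub (interior_subset ht)) (fun hex => by
        have htB := interior_subset (s := B₃) ht
        exact htB.2.2 ⟨htB.1, hex⟩))
  -- two crossings in one block force an interval of crossings: contradiction with `hfin`
  have hblock : ∀ {B : Set ℝ}, B ⊆ I → (MonotoneOn W B ∨ AntitoneOn W B) →
      (∀ {c d t}, c ∈ B → d ∈ B → c ≤ t → t ≤ d → t ∈ B) →
      ∀ {c d}, c ∈ B → d ∈ B → c < d → g c = ℓ c → g d = ℓ d → False := by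
    intro B hB hWB hconn c d hc hd hcd hgc hgd
    have hWc : W c = 0 := (hW_zero_iff c (hB hc)).2 hgc
    have hWd : W d = 0 := (hW_zero_iff d (hB hd)).2 hgd
    obtain ⟨t, ht, hne⟩ := hfin c d (hB hc).1.le hcd (hB hd).2.le
    have htB : t ∈ B := hconn hc hd ht.1.le ht.2.le
    have hWt : W t = 0 :=
      eq_zero_between_of_monotoneOn_or_antitoneOn hWB hc hd htB ht.1.le ht.2.le hWc hWd
    exact hne ((hW_zero_iff t (hB htB)).1 hWt)
  -- order of the blocks: `B₁ < J < B₃`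
  have hJ_not_B₁ : ∀ {c d}, c ∈ J → c < d → d ∈ I → d ∉ B₁ := fun hc hcd _ hd => by
    exact lt_irrefl _ ((hd.2 _ hc).trans hcd)
  have hB₃_not_B₁ : ∀ {c d}, c ∈ B₃ → c < d → d ∉ B₁ := fun hc hcd hd => by
    obtain ⟨j, hj, hjc⟩ := hc.2.1
    exact lt_irrefl _ (((hd.2 j hj).trans hjc).trans hcd)
  have hB₃_not_J : ∀ {c d}, c ∈ B₃ → c < d → d ∉ J := fun hc hcd hd => by
    obtain ⟨j, hj, hjc⟩ := hc.2.1
    exact hc.2.2 (hJ_conn hj hd hjc.le hcd.le)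
  have hafter_J : ∀ {c d}, c ∈ J → c < d → d ∈ I → d ∈ J ∨ d ∈ B₃ := fun hc hcd hdI => by
    rcases hcover _ hdI with hd | hd | hd
    · exact absurd hd (hJ_not_B₁ hc hcd hdI)
    · exact Or.inl hd
    · exact Or.inr hd
  have hafter_B₃ : ∀ {c d}, c ∈ B₃ → c < d → d ∈ I → d ∈ B₃ := fun hc hcd hdI => by
    rcases hcover _ hdI with hd | hd | hd
    · exact absurd hd (hB₃_not_B₁ hc hcd)
    · exact absurd hd (hB₃_not_J hc hcd)
    · exact hd
  -- Rolle: four crossings `c₁ < c₂ < c₃ < c₄`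
  have h₂ : x₂ ∈ I := ⟨h₁.1.trans h12, h23.trans (h34.trans (h45.trans h₅.2))⟩
  have h₃ : x₃ ∈ I := ⟨h₂.1.trans h23, h34.trans (h45.trans h₅.2)⟩
  have h₄ : x₄ ∈ I := ⟨h₃.1.trans h34, h45.trans h₅.2⟩
  have rolle : ∀ {p q : ℝ}, p ∈ I → q ∈ I → p < q → D p = 0 → D q = 0 →
      ∃ c ∈ Ioo p q, g c = ℓ c := by
    intro p q hp hq hpq hDp hDq
    have hsub : Icc p q ⊆ I := hIc.out hp hq
    have hcont : ContinuousOn D (Icc p q) := fun t ht => (hD t (hsub ht)).continuousAt.continuousWithinAt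
    obtain ⟨c, hc, hc'⟩ := exists_hasDerivAt_eq_zero hpq hcont (by rw [hDp, hDq])
      (fun t ht => hD t (hsub (Ioo_subset_Icc_self ht)))
    exact ⟨c, hc, sub_eq_zero.1 hc'⟩
  obtain ⟨c₁, hc₁, hg₁⟩ := rolle h₁ h₂ h12 hz₁ hz₂
  obtain ⟨c₂, hc₂, hg₂⟩ := rolle h₂ h₃ h23 hz₂ hz₃
  obtain ⟨c₃, hc₃, hg₃⟩ := rolle h₃ h₄ h34 hz₃ hz₄
  obtain ⟨c₄, hc₄, hg₄⟩ := rolle h₄ h₅ h45 hz₄ hz₅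
  have hc₁I : c₁ ∈ I := ⟨h₁.1.trans hc₁.1, hc₁.2.trans h₂.2⟩
  have hc₂I : c₂ ∈ I := ⟨h₂.1.trans hc₂.1, hc₂.2.trans h₃.2⟩
  have hc₃I : c₃ ∈ I := ⟨h₃.1.trans hc₃.1, hc₃.2.trans h₄.2⟩
  have hc₄I : c₄ ∈ I := ⟨h₄.1.trans hc₄.1, hc₄.2.trans h₅.2⟩
  have hc12 : c₁ < c₂ := hc₁.2.trans hc₂.1
  have hc23 : c₂ < c₃ := hc₂.2.trans hc₃.1
  have hc34 : c₃ < c₄ := hc₃.2.trans hc₄.1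
  -- the block bookkeeping (ranks are non-decreasing; four points, three blocks)
  have same_B₁ := fun {c d : ℝ} (hc : c ∈ B₁) (hd : d ∈ B₁) (hcd : c < d) (hgc : g c = ℓ c) (hgd : g d = ℓ d) =>
    hblock hB₁_sub (Or.inr hW_B₁) (fun hc hd hct htd => hB₁_conn hc hd hct htd) hc hd hcd hgc hgd
  have same_J := fun {c d : ℝ} (hc : c ∈ J) (hd : d ∈ J) (hcd : c < d) (hgc : g c = ℓ c) (hgd : g d = ℓ d) =>
    hblock hJ_sub (Or.inl hW_J) (fun hc hd hct htd => hJ_conn hc hd hct htd) hc hd hcd hgc hgd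
  have same_B₃ := fun {c d : ℝ} (hc : c ∈ B₃) (hd : d ∈ B₃) (hcd : c < d) (hgc : g c = ℓ c) (hgd : g d = ℓ d) =>
    hblock hB₃_sub (Or.inr hW_B₃) (fun hc hd hct htd => hB₃_conn hc hd hct htd) hc hd hcd hgc hgd
  -- from a point in `J`: the next two crossings finish the argument
  have fromJ : ∀ {c d e : ℝ}, c ∈ J → d ∈ I → e ∈ I → c < d → d < e →
      g c = ℓ c → g d = ℓ d → g e = ℓ e → False := by
    intro c d e hc hdI heI hcd hde hgc hgd hge
    rcases hafter_J hc hcd hdI with hd | hd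
    · exact same_J hc hd hcd hgc hgd
    · exact same_B₃ hd (hafter_B₃ hd hde heI) hde hgd hge
  rcases hcover c₁ hc₁I with k₁ | k₁ | k₁
  · -- `c₁ ∈ B₁`
    rcases hcover c₂ hc₂I with k₂ | k₂ | k₂
    · exact same_B₁ k₁ k₂ hc12 hg₁ hg₂
    · exact fromJ k₂ hc₃I hc₄I hc23 hc34 hg₂ hg₃ hg₄
    · exact same_B₃ k₂ (hafter_B₃ k₂ hc23 hc₃I) hc23 hg₂ hg₃
  · -- `c₁ ∈ J`
    exact fromJ k₁ hc₂I hc₃I hc12 hc23 hg₁ hg₂ hg₃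
  · -- `c₁ ∈ B₃`
    exact same_B₃ k₁ (hafter_B₃ k₁ hc12 hc₂I) hc12 hg₁ hg₂

end ProductPlusOne

end Summit.ValiantsHypothesis.ValiantsHypothesis.Theorems.LacunarySymmetroidMatrixDescartes
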